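import Literature.NumberTheory.Sieve.SmoothParityTernary
import Literature.NumberTheory.Sieve.GoldstonPintzYildirimEulerProduct
import HarnessLib

/-!
# The sieved lower bound for parity-class friable ternary counts: numerical and algebraic lemmas

Topic `Literature/NumberTheory/Sieve`, namespace `Literature.NumberTheory.Sieve.SmoothArcs` (helpers in `Sieved`); a PROVED
tool file for `SmoothParitySieved` ([Harper2016, §5]): the lower bound for the parity-class friable ternary count
`parityTernarySum` minus its sublattice counts at all odd primes `3 ≤ p ≤ y` (a Bonferroni / Brun lower sieve for the
coprimality of the variables).  Contents (all elementary):

* prime-sum numerics (with `GPY.sum_Ioc_rpow_neg_le`: `Σ_{N<n≤M} n^{−a} ≤ N^{1−a}/(a−1)`): `two_rpow_div_le`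
  (`2^{1−s}/(s−1) ≤ 0.501` for `s ≥ 2 − 3·10⁻⁴`), `singLower_ge` (`2(1−2^{−α})³ ≥ 0.249`), `singUpper_le`;
* the weights `r_p = p (p^{−α})³ = p^{−(3α−1)}` (`rweight_eq`, `rweight_mul_le_one`), the dilation condition at `e·p`;
* abstract complex bookkeeping: `re_ge_of_asymptotic` (main term), `re_le_of_asymptotic_rescale` (one sieving prime),
  `plateau_core_ge` (the plateau lower bound in units of `Mv₁Mv₂Mv₃/X₃`), `sieved_arith` (the final arithmetic);
* `norm_parityTernarySum_le_card` (`‖W‖ ≤ #{friable solutions}` for `|p_{c_i}| ≤ 1`), `saddleSize_eq_sqrt_two_pi_mul`,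
  `master_cube_div_le` (`𝓜³/x ≤ E₀² · Mv₁Mv₂Mv₃/X₃`).

## References

* A. J. Harper, Compositio Math. 152 (2016), §5 [Harper2016].
-/

noncomputable section

open Finset Real Complex

namespace Literature.NumberTheory.Sieve

namespace SmoothArcs

namespace Sieved

/-! ### Prime-sum numerics -/

/- `∑_{N < n ≤ M} n^{−a} ≤ N^{1−a}/(a−1)` (`a > 1`, `N ≥ 1`) is `GPY.sum_Ioc_rpow_neg_le`
(`GoldstonPintzYildirimEulerProduct`); it is used with `a = 3α − 1` (small primes) and `a = 7/6` (large primes). -/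

/-- `2^{1−s}/(s−1) ≤ 501/1000` for `s ≥ 2 − 3·10⁻⁴` (Bernoulli: `2^{2−s} ≤ 2^{3·10⁻⁴} ≤ 1 + 3·10⁻⁴`). [folklore] -/
theorem two_rpow_div_le {s : ℝ} (hs : 2 - 3 / 10000 ≤ s) : (2 : ℝ) ^ (1 - s) / (s - 1) ≤ 501 / 1000 := by
  have h1 : (2 : ℝ) ^ (2 - s) ≤ (2 : ℝ) ^ (3 / 10000 : ℝ) :=
    Real.rpow_le_rpow_of_exponent_le one_le_two (by linarith)
  have h2 : (2 : ℝ) ^ (3 / 10000 : ℝ) ≤ 1 + 3 / 10000 := by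
    have h := rpow_one_add_le_one_add_mul_self (s := 1) (by norm_num) (p := 3 / 10000) (by norm_num) (by norm_num)
    norm_num at h ⊢
    exact h
  have h3 : (2 : ℝ) ^ (1 - s) = (2 : ℝ) ^ (2 - s) / 2 := by
    rw [show (1 - s) = (2 - s) - 1 by ring, Real.rpow_sub_one two_ne_zero]
  rw [h3, div_div, div_le_div_iff₀ (by nlinarith) (by norm_num)]
  linarith

/-- `2(1 − 2^{−α})³ ≥ 249/1000` for `α ≥ 1 − 10⁻⁴` (`2^{−α} ≤ 2^{10⁻⁴}/2 ≤ (1 + 10⁻⁴)/2`). [folklore] -/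
theorem singLower_ge {α : ℝ} (hα : 1 - 1 / 10000 ≤ α) : 249 / 1000 ≤ 2 * (1 - (2 : ℝ) ^ (-α)) ^ 3 := by
  have h1 : (2 : ℝ) ^ (-α) ≤ (2 : ℝ) ^ (-(1 - 1 / 10000) : ℝ) :=
    Real.rpow_le_rpow_of_exponent_le one_le_two (by linarith)
  have h2 : (2 : ℝ) ^ (-(1 - 1 / 10000) : ℝ) = (2 : ℝ) ^ (1 / 10000 : ℝ) / 2 := by
    rw [show (-(1 - 1 / 10000) : ℝ) = 1 / 10000 - 1 by ring, Real.rpow_sub_one two_ne_zero]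
  have h3 : (2 : ℝ) ^ (1 / 10000 : ℝ) ≤ 1 + 1 / 10000 := by
    have h := rpow_one_add_le_one_add_mul_self (s := 1) (by norm_num) (p := 1 / 10000) (by norm_num) (by norm_num)
    norm_num at h ⊢
    exact h
  rw [h2] at h1
  have h5 : (9999 / 20000 : ℝ) ≤ 1 - (2 : ℝ) ^ (-α) := by linarith
  have h6 := pow_le_pow_left₀ (by norm_num) h5 3
  norm_num at h6
  linarith

/-- The singular-series majorant `3 (d₁d₂)^α exp(2420(1−α)/(3α − 13/5)) ≤ 9 D₀²` for `1 − 10⁻⁴ ≤ α ≤ 1`,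
`1 ≤ d_i ≤ D₀`. [folklore] -/
theorem singUpper_le {α : ℝ} (hα : 1 - 1 / 10000 ≤ α) (hα1 : α ≤ 1) {d₁ d₂ D₀ : ℕ} (hd₁ : 1 ≤ d₁) (hd₂ : 1 ≤ d₂)
    (hd₁D : d₁ ≤ D₀) (hd₂D : d₂ ≤ D₀) :
    3 * ((d₁ * d₂ : ℕ) : ℝ) ^ α * Real.exp (2420 * (1 - α) / (3 * α - 13 / 5)) ≤ 9 * (D₀ : ℝ) ^ 2 := by
  have hdd1 : (1 : ℝ) ≤ ((d₁ * d₂ : ℕ) : ℝ) := by exact_mod_cast Nat.one_le_iff_ne_zero.2 (Nat.mul_ne_zero (by omega) (by omega))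
  have h1 : ((d₁ * d₂ : ℕ) : ℝ) ^ α ≤ ((d₁ * d₂ : ℕ) : ℝ) ^ (1 : ℝ) := Real.rpow_le_rpow_of_exponent_le hdd1 hα1
  rw [Real.rpow_one] at h1
  have h2 : ((d₁ * d₂ : ℕ) : ℝ) ≤ (D₀ : ℝ) ^ 2 := by
    have : d₁ * d₂ ≤ D₀ * D₀ := Nat.mul_le_mul hd₁D hd₂D
    calc ((d₁ * d₂ : ℕ) : ℝ) ≤ ((D₀ * D₀ : ℕ) : ℝ) := by exact_mod_cast this
      _ = (D₀ : ℝ) ^ 2 := by push_cast; ring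
  have h3 : 2420 * (1 - α) / (3 * α - 13 / 5) ≤ 1 := by
    rw [div_le_one (by linarith)]
    linarith
  have h4 : Real.exp (2420 * (1 - α) / (3 * α - 13 / 5)) ≤ 3 := by
    calc _ ≤ Real.exp 1 := Real.exp_le_exp.2 h3
      _ ≤ 3 := by have := Real.exp_one_lt_d9; linarith
  have h5 : 0 ≤ ((d₁ * d₂ : ℕ) : ℝ) ^ α := by positivity
  calc 3 * ((d₁ * d₂ : ℕ) : ℝ) ^ α * Real.exp (2420 * (1 - α) / (3 * α - 13 / 5)) ≤ 3 * (D₀ : ℝ) ^ 2 * 3 :=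
        mul_le_mul (by linarith) h4 (Real.exp_pos _).le (by positivity)
    _ = 9 * (D₀ : ℝ) ^ 2 := by ring

/-! ### The sieving weights `r_p = p (p^{−α})³` -/

/-- `p (p^{−α})³ = p^{−(3α − 1)}`. [folklore] -/
theorem rweight_eq {p : ℕ} (hp : 0 < p) (α : ℝ) : (p : ℝ) * ((p : ℝ) ^ (-α)) ^ 3 = (p : ℝ) ^ (-(3 * α - 1)) := by
  have hp0 : (0 : ℝ) < p := by exact_mod_cast hp
  rw [show ((p : ℝ) ^ (-α)) ^ 3 = ((p : ℝ) ^ (-α)) ^ ((3 : ℕ) : ℝ) from (Real.rpow_natCast _ 3).symm,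
    ← Real.rpow_mul hp0.le, show -(3 * α - 1) = 1 + -α * ((3 : ℕ) : ℝ) by push_cast; ring, Real.rpow_add hp0,
    Real.rpow_one]

/-- `p (p^{−α})³ · p = p^{2 − 3α} ≤ 1` for `p ≥ 1`, `α ≥ 2/3`. [folklore] -/
theorem rweight_mul_le_one {p : ℕ} (hp : 1 ≤ p) {α : ℝ} (hα : 2 / 3 ≤ α) :
    (p : ℝ) * ((p : ℝ) ^ (-α)) ^ 3 * p ≤ 1 := by
  have hp1 : (1 : ℝ) ≤ p := by exact_mod_cast hp
  rw [rweight_eq (by omega) α, ← Real.rpow_add_one (by positivity) (-(3 * α - 1))]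
  exact Real.rpow_le_one_of_one_le_of_nonpos hp1 (by linarith)

/-- `0 ≤ p (p^{−α})³`. [folklore] -/
theorem rweight_nonneg (p : ℕ) (α : ℝ) : 0 ≤ (p : ℝ) * ((p : ℝ) ^ (-α)) ^ 3 := by positivity

/-- The dilation condition `d₁/e₁ + d₂/e₂ + 1/e₃ ≤ 1` passes to the scalings `e_i p`. [folklore] -/
theorem dil_sum_mul_le {d₁ d₂ e₁ e₂ e₃ p : ℕ} (hp : 1 ≤ p) (he₁ : 1 ≤ e₁) (he₂ : 1 ≤ e₂) (he₃ : 1 ≤ e₃)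
    (h : (d₁ : ℝ) / e₁ + d₂ / e₂ + 1 / e₃ ≤ 1) :
    (d₁ : ℝ) / ((e₁ * p : ℕ) : ℝ) + d₂ / ((e₂ * p : ℕ) : ℝ) + 1 / ((e₃ * p : ℕ) : ℝ) ≤ 1 := by
  have hp1 : (1 : ℝ) ≤ p := by exact_mod_cast hp
  have he₁0 : (0 : ℝ) < e₁ := by exact_mod_cast (show 0 < e₁ by omega)
  have he₂0 : (0 : ℝ) < e₂ := by exact_mod_cast (show 0 < e₂ by omega)
  have he₃0 : (0 : ℝ) < e₃ := by exact_mod_cast (show 0 < e₃ by omega)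
  push_cast
  have heq : (d₁ : ℝ) / (e₁ * p) + d₂ / (e₂ * p) + 1 / (e₃ * p) = ((d₁ : ℝ) / e₁ + d₂ / e₂ + 1 / e₃) / p := by
    field_simp
  rw [heq, div_le_one (by linarith)]
  have h0 : 0 ≤ (d₁ : ℝ) / e₁ + d₂ / e₂ + 1 / e₃ := by positivity
  linarith

/-! ### Abstract complex bookkeeping -/

/-- MAIN TERM: `‖W − 𝔖 M‖ ≤ εQ` with `𝔖` real gives `re W ≥ re 𝔖 · re M − εQ`. [folklore] -/
theorem re_ge_of_asymptotic {W S M : ℂ} {ε Q : ℝ} (hS : S.im = 0) (hW : ‖W - S * M‖ ≤ ε * Q) :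
    S.re * M.re - ε * Q ≤ W.re := by
  have h := Complex.re_le_norm (S * M - W)
  rw [Complex.sub_re, Complex.mul_re, hS, zero_mul, sub_zero, norm_sub_rev] at h
  linarith

/-- ONE SIEVING PRIME, abstract form: `‖W − 𝔖 M'‖ ≤ ε r Q`, `‖M' − r M‖ ≤ r J` with `𝔖` real, `re 𝔖 ≥ 0` give
`re W ≤ r (re 𝔖 · re M + εQ) + re 𝔖 · r J`. [folklore] -/
theorem re_le_of_asymptotic_rescale {W S M M' : ℂ} {r ε Q J : ℝ} (hS : S.im = 0) (hS0 : 0 ≤ S.re)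
    (hW : ‖W - S * M'‖ ≤ ε * r * Q) (hM' : ‖M' - (r : ℂ) * M‖ ≤ r * J) :
    W.re ≤ r * (S.re * M.re + ε * Q) + S.re * (r * J) := by
  have h1 : W.re ≤ (S * M').re + ‖W - S * M'‖ := by
    have := Complex.re_le_norm (W - S * M')
    rw [Complex.sub_re] at this
    linarith
  have h2 : (S * M').re = S.re * M'.re := by rw [Complex.mul_re, hS, zero_mul, sub_zero]
  have h3 : M'.re ≤ r * M.re + r * J := by
    have := Complex.re_le_norm (M' - (r : ℂ) * M)
    rw [Complex.sub_re, Complex.re_ofReal_mul] at this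
    linarith
  have h4 : S.re * M'.re ≤ S.re * (r * M.re + r * J) := mul_le_mul_of_nonneg_left h3 hS0
  rw [h2] at h1
  linarith

/-- The plateau lower bound in units of `Q = Mv₁Mv₂Mv₃/X₃`: if `u_iX_i ≥ 10` (`i = 1, 2`) then
`(Mv₁/X₁)(Mv₂/X₂)(Mv₃/X₃)(u₁X₁ − 1)(u₂X₂ − 1) ≥ (81/100) u₁u₂ Q`. [folklore] -/
theorem plateau_core_ge {Mv₁ Mv₂ Mv₃ X₁ X₂ X₃ u₁ u₂ : ℝ} (hMv₁ : 0 ≤ Mv₁) (hMv₂ : 0 ≤ Mv₂) (hMv₃ : 0 ≤ Mv₃)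
    (hX₁ : 0 < X₁) (hX₂ : 0 < X₂) (hX₃ : 0 < X₃) (hu₁ : 10 ≤ u₁ * X₁) (hu₂ : 10 ≤ u₂ * X₂) :
    81 / 100 * (u₁ * u₂) * (Mv₁ * Mv₂ * Mv₃ / X₃) ≤
      Mv₁ / X₁ * (Mv₂ / X₂) * (Mv₃ / X₃) * ((u₁ * X₁ - 1) * (u₂ * X₂ - 1)) := by
  have h1 : 9 / 10 * (u₁ * X₁) ≤ u₁ * X₁ - 1 := by linarith
  have h2 : 9 / 10 * (u₂ * X₂) ≤ u₂ * X₂ - 1 := by linarith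
  have h12 : 81 / 100 * (u₁ * X₁) * (u₂ * X₂) ≤ (u₁ * X₁ - 1) * (u₂ * X₂ - 1) := by
    calc 81 / 100 * (u₁ * X₁) * (u₂ * X₂) = (9 / 10 * (u₁ * X₁)) * (9 / 10 * (u₂ * X₂)) := by ring
      _ ≤ (u₁ * X₁ - 1) * (u₂ * X₂ - 1) := mul_le_mul h1 h2 (by linarith) (by linarith)
  have hP : 0 ≤ Mv₁ / X₁ * (Mv₂ / X₂) * (Mv₃ / X₃) := by positivity
  calc 81 / 100 * (u₁ * u₂) * (Mv₁ * Mv₂ * Mv₃ / X₃)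
      = Mv₁ / X₁ * (Mv₂ / X₂) * (Mv₃ / X₃) * (81 / 100 * (u₁ * X₁) * (u₂ * X₂)) := by
        field_simp
    _ ≤ _ := mul_le_mul_of_nonneg_left h12 hP

/-- THE FINAL ARITHMETIC of the analytic part: with `re 𝔖 ≥ 0.249`, `re MC ≥ 0.81 κQ`, `S₁ ≤ 0.501`, `ε = κ/200`,
junk `≤ κQ/400`: `re W − Σ_small ≥ (2/25) κ Q`. [folklore] -/
theorem sieved_arith {Wre Ssum Sre M Q κ S₁ Jt : ℝ} (hκ : 0 ≤ κ) (hQ : 0 ≤ Q)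
    (hW : Sre * M - κ / 200 * Q ≤ Wre) (hS : Ssum ≤ S₁ * (Sre * M + κ / 200 * Q) + Jt)
    (hS₁ : S₁ ≤ 501 / 1000) (hSre : 249 / 1000 ≤ Sre) (hM : 81 / 100 * κ * Q ≤ M)
    (hJ : Jt ≤ κ * Q / 400) : 2 / 25 * κ * Q ≤ Wre - Ssum := by
  have h1 : 249 / 1000 * (81 / 100 * κ * Q) ≤ Sre * M := mul_le_mul hSre hM (by positivity) (by linarith)
  have hSM0 : 0 ≤ Sre * M := le_trans (by positivity) h1
  have h2 : Sre * M * (499 / 1000) ≤ Sre * M * (1 - S₁) := mul_le_mul_of_nonneg_left (by linarith) hSM0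
  have h3 : S₁ * (κ / 200 * Q) ≤ 501 / 1000 * (κ / 200 * Q) := mul_le_mul_of_nonneg_right hS₁ (by positivity)
  nlinarith [h1, h2, h3]

/-! ### Counting and saddle-size conversions -/

/-- `‖parityTernarySum‖ ≤ #{(n₁,n₂,n₃) ∈ S(X₁)×S(X₂)×S(X₃) : d₁n₁ + σd₂n₂ = n₃}` for profiles with `|p_{c_i}| ≤ 1`
(drop the parity conditions). [folklore] -/
theorem norm_parityTernarySum_le_card (y : ℕ) (σ : ℤ) (d₁ d₂ : ℕ) (X₁ X₂ X₃ : ℝ) {c₁ c₂ c₃ : ℤ → ℂ}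
    (h₁ : ∀ v, ‖profileFn c₁ v‖ ≤ 1) (h₂ : ∀ v, ‖profileFn c₂ v‖ ≤ 1) (h₃ : ∀ v, ‖profileFn c₃ v‖ ≤ 1) :
    ‖parityTernarySum y σ d₁ d₂ X₁ X₂ X₃ c₁ c₂ c₃‖ ≤
      (#((Nat.smoothNumbersUpTo ⌊X₁⌋₊ (y + 1) ×ˢ Nat.smoothNumbersUpTo ⌊X₂⌋₊ (y + 1) ×ˢ
            Nat.smoothNumbersUpTo ⌊X₃⌋₊ (y + 1)).filter
          (fun t : ℕ × ℕ × ℕ => (d₁ * t.1 : ℤ) + σ * (d₂ * t.2.1) = t.2.2)) : ℝ) := by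
  set T := ((Nat.smoothNumbersUpTo ⌊X₁⌋₊ (y + 1)).filter (fun n => Odd n)) ×ˢ
    (((Nat.smoothNumbersUpTo ⌊X₂⌋₊ (y + 1)).filter (fun n => Odd n)) ×ˢ Nat.smoothNumbersUpTo ⌊X₃⌋₊ (y + 1))
    with hT
  have hsum : parityTernarySum y σ d₁ d₂ X₁ X₂ X₃ c₁ c₂ c₃ =
      ∑ t ∈ T, if (d₁ * t.1 : ℤ) + σ * (d₂ * t.2.1) = t.2.2 then
        profileFn c₁ ((t.1 : ℝ) / X₁) * profileFn c₂ ((t.2.1 : ℝ) / X₂) * starRingEnd ℂ (profileFn c₃ ((t.2.2 : ℝ) / X₃))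
        else 0 := by
    simp only [hT, parityTernarySum, Finset.sum_product]
  have hsub : T ⊆ Nat.smoothNumbersUpTo ⌊X₁⌋₊ (y + 1) ×ˢ Nat.smoothNumbersUpTo ⌊X₂⌋₊ (y + 1) ×ˢ
      Nat.smoothNumbersUpTo ⌊X₃⌋₊ (y + 1) :=
    Finset.product_subset_product (Finset.filter_subset _ _)
      (Finset.product_subset_product (Finset.filter_subset _ _) subset_rfl)
  rw [hsum]
  calc _ ≤ ∑ t ∈ T, ‖if (d₁ * t.1 : ℤ) + σ * (d₂ * t.2.1) = t.2.2 then
        profileFn c₁ ((t.1 : ℝ) / X₁) * profileFn c₂ ((t.2.1 : ℝ) / X₂) * starRingEnd ℂ (profileFn c₃ ((t.2.2 : ℝ) / X₃))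
        else 0‖ := norm_sum_le _ _
    _ ≤ ∑ t ∈ T, (if (d₁ * t.1 : ℤ) + σ * (d₂ * t.2.1) = t.2.2 then (1 : ℝ) else 0) := by
        refine Finset.sum_le_sum fun t _ => ?_
        split_ifs
        · rw [norm_mul, norm_mul, RCLike.norm_conj]
          calc ‖profileFn c₁ ((t.1 : ℝ) / X₁)‖ * ‖profileFn c₂ ((t.2.1 : ℝ) / X₂)‖ * ‖profileFn c₃ ((t.2.2 : ℝ) / X₃)‖
              ≤ 1 * 1 * 1 := mul_le_mul (mul_le_mul (h₁ _) (h₂ _) (norm_nonneg _) zero_le_one) (h₃ _)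
                (norm_nonneg _) (by norm_num)
            _ = 1 := by norm_num
        · rw [norm_zero]
    _ = (#(T.filter (fun t : ℕ × ℕ × ℕ => (d₁ * t.1 : ℤ) + σ * (d₂ * t.2.1) = t.2.2)) : ℝ) := by
        rw [Finset.sum_boole]
    _ ≤ _ := by exact_mod_cast Finset.card_le_card (Finset.filter_subset_filter _ hsub)

/-- `x^α (ζ/√φ) = √(2π) · (x^α ζ/√(2πφ))` (`φ > 0`): Hildebrand–Tenenbaum's saddle size vs. the master mass `𝓜`.
[folklore] -/
theorem saddleSize_eq_sqrt_two_pi_mul {x α ζ φ : ℝ} (hφ : 0 < φ) :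
    x ^ α * (ζ / Real.sqrt φ) = Real.sqrt (2 * Real.pi) * (x ^ α * ζ / Real.sqrt (2 * Real.pi * φ)) := by
  rw [Real.sqrt_mul (by positivity : (0 : ℝ) ≤ 2 * Real.pi)]
  have h2 : Real.sqrt (2 * Real.pi) ≠ 0 := (Real.sqrt_pos.2 (by positivity)).ne'
  have hφ' : Real.sqrt φ ≠ 0 := (Real.sqrt_pos.2 hφ).ne'
  field_simp

/-- `𝓜³/x ≤ E₀² · Mv₁Mv₂Mv₃/(x/e₃)` for `Mv_i = e_i^{−α}𝓜`, `1 ≤ e_i ≤ E₀` (`i = 1, 2`), `1 ≤ e₃`, `0 ≤ α ≤ 1`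
(`e^{−α} ≥ 1/E₀`, `e₃^{−α} e₃ ≥ 1`). [folklore] -/
theorem master_cube_div_le {x M₀ α : ℝ} {e₁ e₂ e₃ E₀ : ℕ} (hx : 0 < x) (hM₀ : 0 ≤ M₀) (hα1 : α ≤ 1)
    (he₁ : 1 ≤ e₁) (he₂ : 1 ≤ e₂) (he₃ : 1 ≤ e₃) (h₁ : e₁ ≤ E₀) (h₂ : e₂ ≤ E₀) :
    M₀ ^ 3 / x ≤ (E₀ : ℝ) ^ 2 *
      (((e₁ : ℝ) ^ (-α) * M₀) * ((e₂ : ℝ) ^ (-α) * M₀) * ((e₃ : ℝ) ^ (-α) * M₀) / (x / e₃)) := by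
  have hE0 : (0 : ℝ) < E₀ := by exact_mod_cast (show 0 < E₀ by omega)
  have key : ∀ {e : ℕ}, 1 ≤ e → e ≤ E₀ → 1 ≤ (E₀ : ℝ) * (e : ℝ) ^ (-α) := by
    intro e he heE
    have he1 : (1 : ℝ) ≤ e := by exact_mod_cast he
    have hE : (e : ℝ) ≤ E₀ := by exact_mod_cast heE
    have h1 : (e : ℝ) ^ (-1 : ℝ) ≤ (e : ℝ) ^ (-α) := Real.rpow_le_rpow_of_exponent_le he1 (by linarith)
    rw [Real.rpow_neg_one] at h1
    calc (1 : ℝ) = (e : ℝ) * (e : ℝ)⁻¹ := (mul_inv_cancel₀ (by positivity)).symm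
      _ ≤ (E₀ : ℝ) * (e : ℝ) ^ (-α) := mul_le_mul hE h1 (by positivity) hE0.le
  have k₃ : 1 ≤ (e₃ : ℝ) ^ (-α) * e₃ := by
    have he1 : (1 : ℝ) ≤ e₃ := by exact_mod_cast he₃
    have h1 : (e₃ : ℝ) ^ (-1 : ℝ) ≤ (e₃ : ℝ) ^ (-α) := Real.rpow_le_rpow_of_exponent_le he1 (by linarith)
    rw [Real.rpow_neg_one] at h1
    calc (1 : ℝ) = (e₃ : ℝ)⁻¹ * e₃ := (inv_mul_cancel₀ (by positivity)).symm
      _ ≤ (e₃ : ℝ) ^ (-α) * e₃ := mul_le_mul_of_nonneg_right h1 (by positivity)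
  have he₃0 : (0 : ℝ) < e₃ := by exact_mod_cast (show 0 < e₃ by omega)
  have hRHS : (E₀ : ℝ) ^ 2 * (((e₁ : ℝ) ^ (-α) * M₀) * ((e₂ : ℝ) ^ (-α) * M₀) * ((e₃ : ℝ) ^ (-α) * M₀) / (x / e₃)) =
      ((E₀ * (e₁ : ℝ) ^ (-α)) * (E₀ * (e₂ : ℝ) ^ (-α)) * ((e₃ : ℝ) ^ (-α) * e₃)) * (M₀ ^ 3 / x) := by
    field_simp
  rw [hRHS]
  have hprod : 1 ≤ (E₀ * (e₁ : ℝ) ^ (-α)) * (E₀ * (e₂ : ℝ) ^ (-α)) * ((e₃ : ℝ) ^ (-α) * e₃) :=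
    one_le_mul_of_one_le_of_one_le (one_le_mul_of_one_le_of_one_le (key he₁ h₁) (key he₂ h₂)) k₃
  calc M₀ ^ 3 / x = 1 * (M₀ ^ 3 / x) := (one_mul _).symm
    _ ≤ _ := mul_le_mul_of_nonneg_right hprod (by positivity)

end Sieved

end SmoothArcs

end Literature.NumberTheory.Sieve

end
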